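import Summits.ValiantsHypothesis.ValiantsHypothesis.Theses.SliceSignRank

/-!
# ValiantsHypothesis / SliceSignRank — item `PolyaOneTwist` (stmt-ValiantsHypothesis-15123), closed

Pólya / Marcus–Minc in sign form: for `n ≥ 3` no real `W` has `sgn σ · Π_i W(σ i, i) > 0` for all
`σ`. Restrict to the six permutations of `{0,1,2}` (fixing the rest): the three even ones and the
three odd ones each use every entry of the `3 × 3` block exactly once, so the product of the three
"even" quantities equals the product of the three "odd" ones — but the former is positive and the
latter negative. HONEST FRAMING: bookkeeping (a classical exercise); nothing here is progress on
`VP ≠ VNP`.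
-/

-- layout Summits/ValiantsHypothesis/ValiantsHypothesis forces the duplicated namespace component
set_option linter.dupNamespace false

namespace Summit.ValiantsHypothesis.ValiantsHypothesis.Theorems.SliceSignRank

/-- **Item `PolyaOneTwist` (stmt-ValiantsHypothesis-15123).** [cite: MarcusMinc1961] -/
theorem polyaOneTwist_proof : Theses.SliceSignRank.PolyaOneTwist := by
  unfold Theses.SliceSignRank.PolyaOneTwist
  rintro n hn ⟨W, hW⟩
  obtain ⟨k, rfl⟩ : ∃ k, n = k + 3 := ⟨n - 3, by omega⟩
  -- the three letters
  set a : Fin (k + 3) := ⟨0, by omega⟩ with ha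
  set b : Fin (k + 3) := ⟨1, by omega⟩ with hb
  set c : Fin (k + 3) := ⟨2, by omega⟩ with hc
  have hab : a ≠ b := by rw [ha, hb]; exact Fin.ne_of_val_ne (by norm_num)
  have hac : a ≠ c := by rw [ha, hc]; exact Fin.ne_of_val_ne (by norm_num)
  have hbc : b ≠ c := by rw [hb, hc]; exact Fin.ne_of_val_ne (by norm_num)
  -- factorization of `Π_i W(σ i, i)` for `σ` supported on `{a, b, c}`
  set R : ℝ := ∏ i ∈ ({a, b, c} : Finset (Fin (k + 3)))ᶜ, W i i with hR
  have hfac : ∀ σ : Equiv.Perm (Fin (k + 3)), (∀ i, i ≠ a → i ≠ b → i ≠ c → σ i = i) →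
      ∏ i, W (σ i) i = W (σ a) a * (W (σ b) b * W (σ c) c) * R := by
    intro σ hσ
    rw [← Finset.prod_mul_prod_compl ({a, b, c} : Finset (Fin (k + 3))) (fun i => W (σ i) i)]
    congr 1
    · rw [Finset.prod_insert (by simp [hab, hac]), Finset.prod_pair hbc]
    · refine Finset.prod_congr rfl (fun i hi => ?_)
      rw [Finset.mem_compl, Finset.mem_insert, Finset.mem_insert, Finset.mem_singleton] at hi
      push Not at hi
      rw [hσ i hi.1 hi.2.1 hi.2.2]
  have hswap : ∀ x y i : Fin (k + 3), i ≠ x → i ≠ y → Equiv.swap x y i = i :=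
    fun x y i hx hy => Equiv.swap_apply_of_ne_of_ne hx hy
  -- the six sign conditions
  -- e1 = id
  have h1 := hW 1
  rw [hfac 1 (fun i _ _ _ => rfl)] at h1
  simp only [Equiv.Perm.sign_one, Units.val_one, Int.cast_one, one_mul, Equiv.Perm.one_apply] at h1
  -- o1 = (a b), o2 = (a c), o3 = (b c)
  have h4 := hW (Equiv.swap a b)
  rw [hfac _ (fun i hia hib _ => hswap a b i hia hib), Equiv.swap_apply_left, Equiv.swap_apply_right,
    hswap a b c hac.symm hbc.symm, Equiv.Perm.sign_swap hab] at h4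
  have h5 := hW (Equiv.swap a c)
  rw [hfac _ (fun i hia _ hic => hswap a c i hia hic), Equiv.swap_apply_left, Equiv.swap_apply_right,
    hswap a c b hab.symm hbc, Equiv.Perm.sign_swap hac] at h5
  have h6 := hW (Equiv.swap b c)
  rw [hfac _ (fun i _ hib hic => hswap b c i hib hic), Equiv.swap_apply_left, Equiv.swap_apply_right,
    hswap b c a hab hac, Equiv.Perm.sign_swap hbc] at h6
  simp only [Units.val_neg, Units.val_one, Int.cast_neg, Int.cast_one] at h4 h5 h6
  -- e2 = (a b)(b c): a ↦ b, b ↦ c, c ↦ a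
  have h2 := hW (Equiv.swap a b * Equiv.swap b c)
  have e2a : (Equiv.swap a b * Equiv.swap b c) a = b := by
    rw [Equiv.Perm.mul_apply, hswap b c a hab hac, Equiv.swap_apply_left]
  have e2b : (Equiv.swap a b * Equiv.swap b c) b = c := by
    rw [Equiv.Perm.mul_apply, Equiv.swap_apply_left, hswap a b c hac.symm hbc.symm]
  have e2c : (Equiv.swap a b * Equiv.swap b c) c = a := by
    rw [Equiv.Perm.mul_apply, Equiv.swap_apply_right, Equiv.swap_apply_right]
  rw [hfac _ (fun i hia hib hic => by rw [Equiv.Perm.mul_apply, hswap b c i hib hic, hswap a b i hia hib]),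
    e2a, e2b, e2c, Equiv.Perm.sign_mul, Equiv.Perm.sign_swap hab, Equiv.Perm.sign_swap hbc] at h2
  -- e3 = (b c)(a b): a ↦ c, b ↦ a, c ↦ b
  have h3 := hW (Equiv.swap b c * Equiv.swap a b)
  have e3a : (Equiv.swap b c * Equiv.swap a b) a = c := by
    rw [Equiv.Perm.mul_apply, Equiv.swap_apply_left, Equiv.swap_apply_left]
  have e3b : (Equiv.swap b c * Equiv.swap a b) b = a := by
    rw [Equiv.Perm.mul_apply, Equiv.swap_apply_right, hswap b c a hab hac]
  have e3c : (Equiv.swap b c * Equiv.swap a b) c = b := by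
    rw [Equiv.Perm.mul_apply, hswap a b c hac.symm hbc.symm, Equiv.swap_apply_right]
  rw [hfac _ (fun i hia hib hic => by rw [Equiv.Perm.mul_apply, hswap a b i hia hib, hswap b c i hib hic]),
    e3a, e3b, e3c, Equiv.Perm.sign_mul, Equiv.Perm.sign_swap hbc, Equiv.Perm.sign_swap hab] at h3
  simp only [neg_mul_neg, Units.val_one, Int.cast_one, one_mul] at h2 h3
  -- even product positive, odd product negative, but they are equal
  have hE : 0 < (W a a * (W b b * W c c) * R) * (W b a * (W c b * W a c) * R) *
      (W c a * (W a b * W b c) * R) := mul_pos (mul_pos h1 h2) h3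
  have h4' : W b a * (W a b * W c c) * R < 0 := by linarith
  have h5' : W c a * (W b b * W a c) * R < 0 := by linarith
  have h6' : W a a * (W c b * W b c) * R < 0 := by linarith
  have hO : (W b a * (W a b * W c c) * R) * (W c a * (W b b * W a c) * R) *
      (W a a * (W c b * W b c) * R) < 0 := mul_neg_of_pos_of_neg (mul_pos_of_neg_of_neg h4' h5') h6'
  have heq : (W a a * (W b b * W c c) * R) * (W b a * (W c b * W a c) * R) *
      (W c a * (W a b * W b c) * R) = (W b a * (W a b * W c c) * R) * (W c a * (W b b * W a c) * R) *
      (W a a * (W c b * W b c) * R) := by ring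
  linarith

end Summit.ValiantsHypothesis.ValiantsHypothesis.Theorems.SliceSignRank
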